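import Summits.AtomisticToContinuum.FouriersLaw.Theorems.BondHeatUncertaintySubdiffusiveBondHeatJunctionRatioPeeling

/-!
# `JunctionRatioPeeling` — file 17b: DEPTH ONE of the contact-law ladder is a THEOREM
# (cell `decomp-a2c`, lens-1 «grading / quantitative ladder», gen 61; beneath file 17a `…JunctionRatioPeeling`)

The floor of the depth ladder of file 17a.  To first order in the imposed difference `δ`, the drop across the bare contact of every long
chain IS the escape deficit: `(T + δ/2) − ⟨p_0²⟩_μ = δ·(E_N + o(1))` and `⟨p_{N−1}²⟩_μ − (T − δ/2) = (T + δ/2) − ⟨p_0²⟩_μ`, uniformly over the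
steady states `μ` at `(T + δ/2, T − δ/2)` (`contactDrop_firstOrder`).  Ingredients, all in tree (import closure of file 16): the
canonical response family with `D_N = (N−1)γE_N` (`exists_canonical_response` = response identity 12237 + weak-NESS uniqueness 0741);
uniqueness again to identify an arbitrary steady state with the Cuneo–Eckmann–Hairer–Rey-Bellet state, which has an exponential energy
moment (`CuneoEckmannHairerReyBellet2018_pinnedChain_holds`), hence all polynomial moments (`LinearResponseFTUR.pinnedChain_polynomialMoments`);
the energy balance `totalCurrent μ = (N−1)γ(⟨p_{N−1}²⟩_μ − T_R)` and the bath balance `γ(T_L − ⟨p_0²⟩_μ) + γ(T_R − ⟨p_{N−1}²⟩_μ) = 0` of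
line `gibbs-ttcf` (`BoundaryKubo.GibbsTtcf.stub_energyBalance`, `bath_balance`; Bonetto–Lebowitz–Rey-Bellet 2000 §5.2).
Consequences: `contactPositivityAt_zero : ContactPositivityAt … 0` and `contactShareAt_one_zero : ContactShareAt … 1 0` for all parameters
and `T > 0` — the first PROVED N-uniform first-order profile statements of the lineage — hence at depth one the peeled door and the door
of record are EQUIVALENT along the Fourier-necessary side: `PeeledBlockLawAt ρ 0 ⟹ RelativeBlockLawAt ρ` outright and
`RelativeBlockLawAt ρ ∧ (E_n → 0) ⟹ PeeledBlockLawAt ρ' 0` (`ρ' < ρ`); globally `peeledLocality_zero_iff_relativeLocality` under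
`EscapeVanishing` (≡ 28286, implied by `AsymptoticSeriesLaw`).  The theorems STOP here: depth two (`d = 1`, the first bond) is the next
grade (file 17a, tags).  No `sorry`; standard axioms; imports file 17a only.
-/

noncomputable section

open MeasureTheory Filter Topology Set
open scoped BigOperators

namespace Summit.AtomisticToContinuum.FouriersLaw.Theorems.SubdiffusiveBondHeat

namespace EscapeGrading

open Literature.MathematicalPhysics.KineticTheory.HeatConduction
open Summit.AtomisticToContinuum.FouriersLaw.Theses.BondHeatUncertainty (BoundedResponse NonBallistic)
open Summit.AtomisticToContinuum.FouriersLaw.Theorems.SubdiffusiveBondHeat.JunctionDefectGrading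
open Summit.AtomisticToContinuum.FouriersLaw.Theorems.BoundaryKubo.GibbsTtcf (stub_energyBalance bath_balance)
open Summit.AtomisticToContinuum.FouriersLaw.Theorems.LinearResponseFTUR (pinnedChain_polynomialMoments)

/-! ## A. The contact drop to first order -/

/-- **The contact drop is `δ·E_N` to first order, uniformly over steady states** (`N ≥ 2`): for every `ε > 0` there is `δ₀ > 0` such that
for `0 < δ < δ₀` and every steady state `μ` of the `N`-chain at `(T + δ/2, T − δ/2)`:
`|((T + δ/2) − ⟨p_0²⟩_μ) − δ·E_N| ≤ δ·ε` and `⟨p_{N−1}²⟩_μ − (T − δ/2) = (T + δ/2) − ⟨p_0²⟩_μ`. [this file] -/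
theorem contactDrop_firstOrder {ω₂ lam β γ T : ℝ} (hω : 0 < ω₂) (hl : 0 < lam) (hβ : 0 < β) (hγ : 0 < γ) (hT : 0 < T)
    {N : ℕ} (hN : 2 ≤ N) {ε : ℝ} (hε : 0 < ε) :
    ∃ δ₀ : ℝ, 0 < δ₀ ∧ ∀ δ : ℝ, 0 < δ → δ < δ₀ →
      ∀ μ : Measure (PhaseSpace N), (pinnedChain ω₂ lam β γ).IsSteadyState N (T + δ / 2) (T - δ / 2) μ →
        |((T + δ / 2) - ∫ x, x.2 ⟨0, by omega⟩ ^ 2 ∂μ) - δ * escapeDeficit ω₂ lam β γ T N| ≤ δ * ε ∧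
        (∫ x, x.2 ⟨N - 1, by omega⟩ ^ 2 ∂μ) - (T - δ / 2) = (T + δ / 2) - ∫ x, x.2 ⟨0, by omega⟩ ^ 2 ∂μ := by
  obtain ⟨M, rfl⟩ : ∃ M, N = M + 1 := ⟨N - 1, by omega⟩
  obtain ⟨μf, hμf, D, hD, hDE⟩ := exists_canonical_response hω hl hβ hγ hT
  have huniq := bondHeatUncertainty_nessUnique_holds ω₂ lam β γ hω hl hβ hγ
  have hM1 : (1 : ℝ) ≤ M := by
    have h : 1 ≤ M := by omega
    exact_mod_cast h
  have hMγ : 0 < (M : ℝ) * γ := mul_pos (by linarith) hγ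
  -- the response limit along the canonical family, in `ε`–`δ` form
  have hlim := hD (M + 1)
  have hcast : (((M + 1 : ℕ) : ℝ) - 1) = (M : ℝ) := by push_cast; ring
  rw [hDE (M + 1) (Nat.succ_pos M), hcast] at hlim
  have hεM : 0 < ε * ((M : ℝ) * γ) := mul_pos hε hMγ
  obtain ⟨δ₁, hδ₁, hδ₁'⟩ := Metric.tendsto_nhdsWithin_nhds.1 hlim _ hεM
  refine ⟨min δ₁ T, lt_min hδ₁ hT, fun δ hδ hδlt μ hμ => ?_⟩
  have hδ1 : δ < δ₁ := lt_of_lt_of_le hδlt (min_le_left _ _)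
  have hδT : δ < T := lt_of_lt_of_le hδlt (min_le_right _ _)
  have hTL : 0 < T + δ / 2 := by linarith
  have hTR : 0 < T - δ / 2 := by linarith
  -- weak-NESS uniqueness: `μ` is the canonical steady state, and the Cuneo–Eckmann–Hairer–Rey-Bellet state
  have hμeq : μ = μf (M + 1) (T + δ / 2) (T - δ / 2) :=
    huniq (M + 1) _ _ hTL hTR μ _ hμ (hμf (M + 1) _ _ hTL hTR)
  obtain ⟨ν, hν, -, hνexp⟩ := CuneoEckmannHairerReyBellet2018_pinnedChain_holds ω₂ lam β γ hω hl hβ hγ (M + 1)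
    (T + δ / 2) (T - δ / 2) (Nat.succ_pos M) hTL hTR
  have hμν : μ = ν := huniq (M + 1) _ _ hTL hTR μ ν hμ hν
  -- exponential, hence polynomial, energy moments of `μ`
  have hmax : max (T + δ / 2) (T - δ / 2) = T + δ / 2 := max_eq_left (by linarith)
  have hϑ : 0 < 1 / (2 * (T + δ / 2)) := by positivity
  have hϑlt : 1 / (2 * (T + δ / 2)) < 1 / max (T + δ / 2) (T - δ / 2) := by
    rw [hmax]
    exact one_div_lt_one_div_of_lt hTL (by linarith)
  have hint : Integrable (fun x => Real.exp (1 / (2 * (T + δ / 2)) * (pinnedChain ω₂ lam β γ).hamiltonian (M + 1) x)) μ := by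
    rw [hμν]
    exact hνexp _ hϑ hϑlt
  have hmom := pinnedChain_polynomialMoments ω₂ lam β γ hω.le hl.le hβ.le (M + 1) μ _ hϑ hint
  -- energy balance (line `gibbs-ttcf`): total current = `M·γ·(⟨p_M²⟩ − T_R)`, and `γ(T_L − ⟨p_0²⟩) + γ(T_R − ⟨p_M²⟩) = 0`
  have hcur := stub_energyBalance ω₂ lam β γ hω hl hβ hγ M (T + δ / 2) (T - δ / 2) hTL hTR μ hμ ⟨_, hϑ, hint⟩
  have hbal := bath_balance hω hl.le hβ.le hγ.le hTL.le hTR.le hμ hmom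
  have h0 : (0 : Fin (M + 1)) = ⟨0, by omega⟩ := rfl
  have hlast : Fin.last M = ⟨M + 1 - 1, by omega⟩ := Fin.ext (by simp)
  rw [h0, hlast] at hbal
  rw [hlast] at hcur
  have hends : (∫ x, x.2 ⟨M + 1 - 1, by omega⟩ ^ 2 ∂μ) - (T - δ / 2) = (T + δ / 2) - ∫ x, x.2 ⟨0, by omega⟩ ^ 2 ∂μ := by
    have h1 : γ * (((∫ x, x.2 ⟨M + 1 - 1, by omega⟩ ^ 2 ∂μ) - (T - δ / 2))
        - ((T + δ / 2) - ∫ x, x.2 ⟨0, by omega⟩ ^ 2 ∂μ)) = 0 := by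
      linarith [hbal]
    have h2 := (mul_eq_zero.1 h1).resolve_left hγ.ne'
    linarith [h2]
  -- the `ε`–`δ` bound at `x = δ`
  have hmem : δ ∈ ({0}ᶜ : Set ℝ) := by simp [hδ.ne']
  have hdd : dist δ 0 < δ₁ := by rw [Real.dist_eq, sub_zero, abs_of_pos hδ]; exact hδ1
  have hdist := hδ₁' hmem hdd
  rw [← hμeq, Real.dist_eq, hcur, hends] at hdist
  have hδne : δ ≠ 0 := hδ.ne'
  have hMγne : (M : ℝ) * γ ≠ 0 := hMγ.ne'
  refine ⟨?_, hends⟩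
  set drop := (T + δ / 2) - ∫ x, x.2 ⟨0, by omega⟩ ^ 2 ∂μ with hdrop
  have e : drop - δ * escapeDeficit ω₂ lam β γ T (M + 1)
      = (δ / ((M : ℝ) * γ))
        * (((M : ℝ) * γ * drop) / δ - (M : ℝ) * γ * escapeDeficit ω₂ lam β γ T (M + 1)) := by
    field_simp
  rw [e, abs_mul, abs_of_pos (div_pos hδ hMγ)]
  calc δ / ((M : ℝ) * γ) * |((M : ℝ) * γ * drop) / δ - (M : ℝ) * γ * escapeDeficit ω₂ lam β γ T (M + 1)|
      ≤ δ / ((M : ℝ) * γ) * (ε * ((M : ℝ) * γ)) :=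
        mul_le_mul_of_nonneg_left hdist.le (div_pos hδ hMγ).le
    _ = δ * ε := by
        field_simp

/-! ## B. Depth one of the ladder: both contact laws hold at `d = 0` -/

/-- **`ContactPositivityAt … 0`** — no first-order overshoot at the contact sites: the contact drop is `δ·(E_N + o(1)) ≥ −εδ` since
`E_N > 0` (`escapeDeficit_pos`). [this file] -/
theorem contactPositivityAt_zero {ω₂ lam β γ T : ℝ} (hω : 0 < ω₂) (hl : 0 < lam) (hβ : 0 < β) (hγ : 0 < γ) (hT : 0 < T) :
    ContactPositivityAt ω₂ lam β γ T 0 := by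
  refine ⟨2, fun N hN _h ε hε => ?_⟩
  obtain ⟨δ₀, hδ₀, h⟩ := contactDrop_firstOrder hω hl hβ hγ hT hN hε
  refine ⟨δ₀, hδ₀, fun δ hδ hδlt μ hμ => ?_⟩
  obtain ⟨habs, hends⟩ := h δ hδ hδlt μ hμ
  have hE : 0 ≤ δ * escapeDeficit ω₂ lam β γ T N := mul_nonneg hδ.le (escapeDeficit_pos hω hl hβ hγ hT hN).le
  have hlow : -(δ * ε) ≤ (T + δ / 2) - ∫ x, x.2 ⟨0, by omega⟩ ^ 2 ∂μ := by
    linarith [(abs_le.1 habs).1]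
  refine ⟨hlow, ?_⟩
  have e : (⟨N - 1 - 0, by omega⟩ : Fin N) = ⟨N - 1, by omega⟩ := Fin.ext (Nat.sub_zero _)
  rw [e, hends]
  exact hlow

/-- **`ContactShareAt … 1 0`** — the contact region of depth one carries at most ONE contact drop (it IS the contact drop):
`δ·(E_N + o(1)) ≤ δ·(1·E_N + ε)`. [this file] -/
theorem contactShareAt_one_zero {ω₂ lam β γ T : ℝ} (hω : 0 < ω₂) (hl : 0 < lam) (hβ : 0 < β) (hγ : 0 < γ) (hT : 0 < T) :
    ContactShareAt ω₂ lam β γ T 1 0 := by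
  refine ⟨2, fun N hN _h ε hε => ?_⟩
  obtain ⟨δ₀, hδ₀, h⟩ := contactDrop_firstOrder hω hl hβ hγ hT hN hε
  refine ⟨δ₀, hδ₀, fun δ hδ hδlt μ hμ => ?_⟩
  obtain ⟨habs, hends⟩ := h δ hδ hδlt μ hμ
  have hup : (T + δ / 2) - ∫ x, x.2 ⟨0, by omega⟩ ^ 2 ∂μ ≤ δ * (1 * escapeDeficit ω₂ lam β γ T N + ε) := by
    have := (abs_le.1 habs).2
    linarith
  refine ⟨hup, ?_⟩
  have e : (⟨N - 1 - 0, by omega⟩ : Fin N) = ⟨N - 1, by omega⟩ := Fin.ext (Nat.sub_zero _)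
  rw [e, hends]
  exact hup

/-- `ContactPositivity 0` (all parameters and temperatures). [this file] -/
theorem contactPositivity_zero : ContactPositivity 0 := fun _ _ _ _ hω hl hβ hγ _ hT =>
  contactPositivityAt_zero hω hl hβ hγ hT

/-- `ContactShare 0` with the constant `C = 1`. [this file] -/
theorem contactShare_zero : ContactShare 0 := fun _ _ _ _ hω hl hβ hγ _ hT =>
  ⟨1, contactShareAt_one_zero hω hl hβ hγ hT⟩

/-! ## C. At depth one the peeled door IS the door (along the Fourier-necessary side) -/

/-- **`PeeledBlockLawAt ρ 0 ⟹ RelativeBlockLawAt ρ`** outright. [this file] -/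
theorem relativeBlockLawAt_of_peeled_zero {ω₂ lam β γ T ρ : ℝ} {L₀ : ℕ} (hω : 0 < ω₂) (hl : 0 < lam) (hβ : 0 < β) (hγ : 0 < γ)
    (hT : 0 < T) (h : PeeledBlockLawAt ω₂ lam β γ T ρ 0 L₀) : RelativeBlockLawAt ω₂ lam β γ T ρ L₀ :=
  relativeBlockLawAt_of_peeled (contactPositivityAt_zero hω hl hβ hγ hT) h

/-- **`RelativeBlockLawAt ρ ∧ (E_n → 0) ⟹ PeeledBlockLawAt ρ' 0`** for every `ρ' < ρ`. [this file] -/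
theorem peeled_zero_of_relativeBlockLawAt {ω₂ lam β γ T ρ ρ' : ℝ} {L₀ : ℕ} (hω : 0 < ω₂) (hl : 0 < lam) (hβ : 0 < β)
    (hγ : 0 < γ) (hT : 0 < T) (hρ' : ρ' < ρ) (hV : Tendsto (fun n : ℕ => escapeDeficit ω₂ lam β γ T n) atTop (𝓝 0))
    (h : RelativeBlockLawAt ω₂ lam β γ T ρ L₀) : PeeledBlockLawAt ω₂ lam β γ T ρ' 0 L₀ :=
  peeled_of_relativeBlockLawAt hω hl hβ hγ hT hρ' h (contactShareAt_one_zero hω hl hβ hγ hT) hV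

/-- `PeeledLocalityLaw ρ 0 ⟹ RelativeLocalityLaw ρ`. [this file · frame] -/
theorem relativeLocalityLaw_of_peeledLocalityLaw_zero {ρ : ℝ} (h : PeeledLocalityLaw ρ 0) : RelativeLocalityLaw ρ :=
  relativeLocalityLaw_of_peeled contactPositivity_zero h

/-- `RelativeLocalityLaw ρ ∧ EscapeVanishing ⟹ PeeledLocalityLaw ρ' 0` (`ρ' < ρ`). [this file · frame] -/
theorem peeledLocalityLaw_zero_of_relativeLocalityLaw {ρ ρ' : ℝ} (hρ' : ρ' < ρ) (hL : RelativeLocalityLaw ρ)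
    (hV : EscapeVanishing) : PeeledLocalityLaw ρ' 0 :=
  peeledLocalityLaw_of_relativeLocalityLaw hρ' hL contactShare_zero hV

/-- **Depth-one peeling is an equivalence of doors** (given `EscapeVanishing` ≡ 28286, a consequence of `AsymptoticSeriesLaw`):
`(∀ ρ < 1, PeeledLocalityLaw ρ 0) ↔ (∀ ρ < 1, RelativeLocalityLaw ρ)`. [this file · frame] -/
theorem peeledLocality_zero_iff_relativeLocality (hV : EscapeVanishing) :
    (∀ ρ : ℝ, ρ < 1 → PeeledLocalityLaw ρ 0) ↔ (∀ ρ : ℝ, ρ < 1 → RelativeLocalityLaw ρ) :=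
  ⟨fun h ρ hρ => relativeLocalityLaw_of_peeledLocalityLaw_zero (h ρ hρ), fun h ρ hρ =>
    peeledLocalityLaw_zero_of_relativeLocalityLaw (ρ := (1 + ρ) / 2) (by linarith) (h _ (by linarith)) hV⟩

/-- The depth-one node into `AsymptoticSeriesLaw`, by name. [frame] -/
theorem asymptoticSeriesLaw_of_peeled_zero_of_escapeInfZero (hL : ∀ ρ : ℝ, ρ < 1 → PeeledLocalityLaw ρ 0)
    (hI : EscapeInfZero) : AsymptoticSeriesLaw :=
  asymptoticSeriesLaw_of_peeled_of_escapeInfZero hL contactPositivity_zero hI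

/-- The depth-one node into 11071, by name: `(∀ ρ < 1, PeeledLocalityLaw ρ 0) ∧ EscapeInfZero ∧ SubOhmicBootstrap ⟹ BoundedResponse`. [frame] -/
theorem boundedResponse_of_peeled_zero_of_escapeInfZero_of_subOhmicBootstrap
    (hL : ∀ ρ : ℝ, ρ < 1 → PeeledLocalityLaw ρ 0) (hI : EscapeInfZero) (hB : SubOhmicBootstrap) : BoundedResponse :=
  boundedResponse_of_peeled_of_escapeInfZero_of_subOhmicBootstrap hL contactPositivity_zero hI hB

end EscapeGrading

end Summit.AtomisticToContinuum.FouriersLaw.Theorems.SubdiffusiveBondHeat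

end
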